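import Summits.Ventures.CertifiedManyBodySolver.Downfold.EmeryOrbitalWeightCheck
import HarnessLib

/-!
# The Cu-d weight of the NODAL Fermi-surface Bloch state in closed form, and its doping lever as a THEOREM:
# `w_node(ε) = 2t_pd²(Δ + ε)/(2t_pd²(Δ + 2ε) + (t_pp − t_pp′)ε²)` is strictly DECREASING in the Fermi energy — hole doping makes the nodal state more Cu-like
# in every charge-transfer σ model (`Δ > 0`, `t_pp ≥ t_pp′ ≥ 0`)

Venture CertifiedManyBodySolver, cell `pub/hubbard-downfold` (stage S1; INFLATION-RULES-3to1-B §B.23 «INFL-3to1 by sign of doping», §B.72 (b′)/(f) the certified doping lever of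
the Fermi-surface weight), seat hubbard-downfold-mod-4 (technique B, g28); namespace `Summit.Ventures.CertifiedManyBodySolver.Downfold.Emery`. Sequel of `EmeryOrbitalWeight`
(`dWeight`, the two-level axis form `dWeight_axis`) and `EmeryOrbitalWeightCheck` (`xNode = fsD1/(2fsN1)`, `dQuad_eq_fsD1_sub`). Everything PROVED (0 sorry; elementary algebra).
WHAT THIS IS NOT: a statement about any material; `U = 0` one-body kinematics of the σ model; the antinodal lever (census `EmeryFermiDWeightVKYMR26X*`, 34/34 by kernel
decision) is NOT proved in general here — only the node decouples to a two-level problem.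

* §1 ON THE ZONE DIAGONAL the `d`–`(p_x − p_y)` block decouples (`EmeryBilayerMirror.charCubic_diag`): with `A = Δ + 4t_pp′x + ε`, `B = 4t_pp x` one has `minorD = (A − B)(A + B)`,
  `minorX = minorY = εA − 4t_pd²x`, and on the conduction band (`dQuad = ε(A − B) − 8t_pd²x = 0`) the d-weight is the TWO-LEVEL form `dWeight(x, x, ε) = G/(G + ε)`,
  `G = nodeGap = Δ + 4(t_pp′ − t_pp)x + ε = A − B > 0` (`dWeight_diag`).
* §2 AT THE NODE OF THE `ε`-CONTOUR (`x = xNode(ε)`): `G·(4t_pd² + 2(t_pp − t_pp′)ε) = 4t_pd²(Δ + ε)` (`nodeGap_xNode`), hence the CLOSED FORM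
  `dWeightNode(ε) = 2t_pd²(Δ + ε)/(2t_pd²(Δ + 2ε) + (t_pp − t_pp′)ε²)` (`dWeightNode_eq`) — no `x`, no square root.
* §3 THE LEVER: `N₁D₂ − N₂D₁ = 2t_pd²(ε₂ − ε₁)[2t_pd²Δ + (t_pp − t_pp′)(Δ(ε₁ + ε₂) + ε₁ε₂)] > 0`, so **`0 < ε₁ < ε₂ ⇒ dWeightNode(ε₂) < dWeightNode(ε₁)`**
  (`dWeightNode_strictAnti`): LOWERING the Fermi energy (hole doping) raises the Cu-d weight of the nodal state, RAISING it (electron doping) lowers it — the one-body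
  «by sign» statement of §B.23 for EVERY σ set in the regime, of which the per-plane certificates `doping_lever_rows` / `tp_by_sign_rows` (node part) are instances;
  bounds `0 < dWeightNode < 1` (`dWeightNode_mem_Ioo`) and `1/2 < dWeightNode ↔ (t_pp − t_pp′)ε² < 2t_pd²Δ` (`half_lt_dWeightNode_iff`).

Sources: three-band model [HybertsenSchluterChristensen1989, Eq. (1)]; diagonal decoupling [AndersenEtAl1995, §6, Eq. (24)]; [folklore] two-level algebra.
-/

noncomputable section

namespace Summit.Ventures.CertifiedManyBodySolver.Downfold.Emery

open Real Set

/-! ## §1 The diagonal two-level form -/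

/-- The nodal gap function `G = Δ + 4(t_pp′ − t_pp)x + ε` (`= A − B`, the `d`-to-`(p_x − p_y)` level distance plus `ε`). [folklore] -/
def nodeGap (Δ tpp c x ε : ℝ) : ℝ := Δ + 4 * (c - tpp) * x + ε

/-- `dQuad = ε·G − 8t_pd²x`. [folklore] -/
theorem dQuad_eq_nodeGap (Δ tpd tpp c x ε : ℝ) : dQuad Δ tpd tpp c x ε = ε * nodeGap Δ tpp c x ε - 8 * tpd ^ 2 * x := by
  unfold dQuad nodeGap
  ring

/-- On the diagonal conduction band (`dQuad = 0`, `x > 0`, `ε > 0`, `t_pd ≠ 0`) the gap function is positive: `ε·G = 8t_pd²x > 0`. [folklore] -/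
theorem nodeGap_pos {Δ tpd tpp c x ε : ℝ} (hx : 0 < x) (hε : 0 < ε) (htpd : tpd ≠ 0) (hq : dQuad Δ tpd tpp c x ε = 0) :
    0 < nodeGap Δ tpp c x ε := by
  rw [dQuad_eq_nodeGap] at hq
  have ht : 0 < tpd ^ 2 := lt_of_le_of_ne (sq_nonneg _) (Ne.symm (pow_ne_zero 2 htpd))
  have h8 : 0 < ε * nodeGap Δ tpp c x ε := by nlinarith [mul_pos ht hx]
  exact pos_of_mul_pos_right h8 hε.le

/-- **THE TWO-LEVEL FORM ON THE DIAGONAL**: on the conduction band of the zone diagonal (`dQuad(x, ε) = 0`; `Δ, t_pp′, t_pp ≥ 0`, `x, ε > 0`, `t_pd ≠ 0`)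
`dWeight(x, x, ε) = G/(G + ε)` with `G = nodeGap`. [cite: AndersenEtAl1995, §6, Eq. (24)] -/
theorem dWeight_diag {Δ tpd tpp c x ε : ℝ} (hΔ : 0 ≤ Δ) (hc : 0 ≤ c) (htpp : 0 ≤ tpp) (hx : 0 < x) (hε : 0 < ε) (htpd : tpd ≠ 0)
    (hq : dQuad Δ tpd tpp c x ε = 0) :
    dWeight Δ tpd tpp c x x ε = nodeGap Δ tpp c x ε / (nodeGap Δ tpp c x ε + ε) := by
  have hG := nodeGap_pos hx hε htpd hq
  have hAB : 0 < (Δ + 4 * c * x + ε) + 4 * tpp * x := by positivity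
  have hsum : minorD Δ tpp c x x ε + minorX Δ tpd c x ε + minorY Δ tpd c x ε =
      ((Δ + 4 * c * x + ε) + 4 * tpp * x) * (nodeGap Δ tpp c x ε + ε) := by
    unfold minorD minorX minorY nodeGap
    unfold dQuad at hq
    linear_combination hq
  have hD : minorD Δ tpp c x x ε = nodeGap Δ tpp c x ε * ((Δ + 4 * c * x + ε) + 4 * tpp * x) := by
    unfold minorD nodeGap
    ring
  unfold dWeight
  rw [hsum, hD, div_eq_div_iff (by positivity) (by positivity)]
  ring

/-! ## §2 The node of the `ε`-contour: closed form -/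

/-- `dQuad` vanishes at `xNode` (`fsN1 ≠ 0`). [folklore] -/
theorem dQuad_xNode {Δ tpd tpp c ε : ℝ} (hN1 : fsN1 tpd tpp c ε ≠ 0) : dQuad Δ tpd tpp c (xNode Δ tpd tpp c ε) ε = 0 := by
  rw [dQuad_eq_fsD1_sub, xNode]
  field_simp
  ring

/-- `fsN1 = 4t_pd² + 2ε(t_pp − t_pp′) > 0` in the regime. [folklore] -/
theorem fsN1_pos {tpd tpp c ε : ℝ} (hg : c ≤ tpp) (hε : 0 ≤ ε) (htpd : tpd ≠ 0) : 0 < fsN1 tpd tpp c ε := by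
  unfold fsN1
  have ht : 0 < tpd ^ 2 := lt_of_le_of_ne (sq_nonneg _) (Ne.symm (pow_ne_zero 2 htpd))
  nlinarith [mul_nonneg hε (sub_nonneg.2 hg)]

/-- `xNode > 0` for `ε > 0`, `Δ ≥ 0` in the regime. [folklore] -/
theorem xNode_pos {Δ tpd tpp c ε : ℝ} (hΔ : 0 ≤ Δ) (hg : c ≤ tpp) (hε : 0 < ε) (htpd : tpd ≠ 0) : 0 < xNode Δ tpd tpp c ε := by
  unfold xNode
  have hN := fsN1_pos hg hε.le htpd
  have hD : 0 < fsD1 Δ ε := by unfold fsD1; positivity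
  positivity

/-- **At the node the gap function satisfies `G·(4t_pd² + 2(t_pp − t_pp′)ε) = 4t_pd²(Δ + ε)`** (the `x`-dependence cancels). [folklore] -/
theorem nodeGap_xNode {Δ tpd tpp c ε : ℝ} (hN1 : fsN1 tpd tpp c ε ≠ 0) :
    nodeGap Δ tpp c (xNode Δ tpd tpp c ε) ε * (4 * tpd ^ 2 + 2 * (tpp - c) * ε) = 4 * tpd ^ 2 * (Δ + ε) := by
  have e : 4 * tpd ^ 2 + 2 * (tpp - c) * ε = fsN1 tpd tpp c ε := by unfold fsN1; ring
  rw [e]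
  unfold nodeGap xNode fsD1
  field_simp
  unfold fsN1
  ring

/-- **The Cu-d weight of the NODAL Bloch state of the `ε`-contour** (as a function of the energy alone). [folklore] -/
def dWeightNode (Δ tpd tpp c ε : ℝ) : ℝ := dWeight Δ tpd tpp c (xNode Δ tpd tpp c ε) (xNode Δ tpd tpp c ε) ε

/-- **CLOSED FORM**: `dWeightNode(ε) = 2t_pd²(Δ + ε)/(2t_pd²(Δ + 2ε) + (t_pp − t_pp′)ε²)` (`Δ, t_pp′ ≥ 0`, `t_pp ≥ t_pp′`, `ε > 0`, `t_pd ≠ 0`). [folklore] -/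
theorem dWeightNode_eq {Δ tpd tpp c ε : ℝ} (hΔ : 0 ≤ Δ) (hc : 0 ≤ c) (hg : c ≤ tpp) (hε : 0 < ε) (htpd : tpd ≠ 0) :
    dWeightNode Δ tpd tpp c ε = 2 * tpd ^ 2 * (Δ + ε) / (2 * tpd ^ 2 * (Δ + 2 * ε) + (tpp - c) * ε ^ 2) := by
  have hN1 := fsN1_pos hg hε.le htpd
  have hx := xNode_pos hΔ hg hε htpd
  have hq := dQuad_xNode (Δ := Δ) hN1.ne'
  have ht : 0 < tpd ^ 2 := lt_of_le_of_ne (sq_nonneg _) (Ne.symm (pow_ne_zero 2 htpd))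
  have hG := nodeGap_pos hx hε htpd hq
  have key := nodeGap_xNode (Δ := Δ) hN1.ne'
  unfold dWeightNode
  rw [dWeight_diag hΔ hc (le_trans hc hg) hx hε htpd hq]
  have hden : 0 < 2 * tpd ^ 2 * (Δ + 2 * ε) + (tpp - c) * ε ^ 2 := by
    have : 0 ≤ (tpp - c) * ε ^ 2 := mul_nonneg (sub_nonneg.2 hg) (sq_nonneg _)
    positivity
  rw [div_eq_div_iff (by positivity) hden.ne']
  have hF : 0 < 4 * tpd ^ 2 + 2 * (tpp - c) * ε := by nlinarith [mul_nonneg hε.le (sub_nonneg.2 hg)]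
  -- multiply the target identity by (4tpd² + 2(tpp − c)ε) > 0 and use `key`
  have goal : (nodeGap Δ tpp c (xNode Δ tpd tpp c ε) ε * (2 * tpd ^ 2 * (Δ + 2 * ε) + (tpp - c) * ε ^ 2)
      - 2 * tpd ^ 2 * (Δ + ε) * (nodeGap Δ tpp c (xNode Δ tpd tpp c ε) ε + ε)) * (4 * tpd ^ 2 + 2 * (tpp - c) * ε) = 0 := by
    linear_combination ((2 * tpd ^ 2 * (Δ + 2 * ε) + (tpp - c) * ε ^ 2) - 2 * tpd ^ 2 * (Δ + ε)) * key
  have := (mul_eq_zero.1 goal).resolve_right hF.ne'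
  linarith

/-! ## §3 The doping lever at the node -/

/-- **THE NODAL d-WEIGHT IS STRICTLY DECREASING IN THE FERMI ENERGY** (`Δ > 0`, `0 ≤ t_pp′ ≤ t_pp`, `t_pd ≠ 0`): `0 < ε₁ < ε₂ ⇒ dWeightNode(ε₂) < dWeightNode(ε₁)`.
Hole doping (lower `ε_F`) ⇒ a MORE Cu-like nodal quasiparticle; electron doping ⇒ less — for every σ set in the regime. [folklore] -/
theorem dWeightNode_strictAnti {Δ tpd tpp c ε₁ ε₂ : ℝ} (hΔ : 0 < Δ) (hc : 0 ≤ c) (hg : c ≤ tpp) (htpd : tpd ≠ 0)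
    (h1 : 0 < ε₁) (h12 : ε₁ < ε₂) :
    dWeightNode Δ tpd tpp c ε₂ < dWeightNode Δ tpd tpp c ε₁ := by
  have h2 : 0 < ε₂ := h1.trans h12
  rw [dWeightNode_eq hΔ.le hc hg h2 htpd, dWeightNode_eq hΔ.le hc hg h1 htpd]
  have ht : 0 < tpd ^ 2 := lt_of_le_of_ne (sq_nonneg _) (Ne.symm (pow_ne_zero 2 htpd))
  have hg' : 0 ≤ tpp - c := sub_nonneg.2 hg
  have hD1 : 0 < 2 * tpd ^ 2 * (Δ + 2 * ε₁) + (tpp - c) * ε₁ ^ 2 := by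
    have : 0 ≤ (tpp - c) * ε₁ ^ 2 := mul_nonneg hg' (sq_nonneg _)
    positivity
  have hD2 : 0 < 2 * tpd ^ 2 * (Δ + 2 * ε₂) + (tpp - c) * ε₂ ^ 2 := by
    have : 0 ≤ (tpp - c) * ε₂ ^ 2 := mul_nonneg hg' (sq_nonneg _)
    positivity
  rw [div_lt_div_iff₀ hD2 hD1]
  have key : 2 * tpd ^ 2 * (Δ + ε₁) * (2 * tpd ^ 2 * (Δ + 2 * ε₂) + (tpp - c) * ε₂ ^ 2)
      - 2 * tpd ^ 2 * (Δ + ε₂) * (2 * tpd ^ 2 * (Δ + 2 * ε₁) + (tpp - c) * ε₁ ^ 2)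
      = 2 * tpd ^ 2 * (ε₂ - ε₁) * (2 * tpd ^ 2 * Δ + (tpp - c) * (Δ * (ε₁ + ε₂) + ε₁ * ε₂)) := by ring
  have hpos : 0 < 2 * tpd ^ 2 * (ε₂ - ε₁) * (2 * tpd ^ 2 * Δ + (tpp - c) * (Δ * (ε₁ + ε₂) + ε₁ * ε₂)) := by
    have hA : 0 < 2 * tpd ^ 2 * Δ + (tpp - c) * (Δ * (ε₁ + ε₂) + ε₁ * ε₂) := by
      have : 0 ≤ (tpp - c) * (Δ * (ε₁ + ε₂) + ε₁ * ε₂) := by positivity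
      positivity
    have hB : 0 < ε₂ - ε₁ := sub_pos.2 h12
    positivity
  linarith

/-- `0 < dWeightNode < 1` in the regime (the nodal conduction state is never purely Cu-d; it is MORE than half Cu-d exactly when `(t_pp − t_pp′)ε² < 2t_pd²Δ`,
`half_lt_dWeightNode_iff`). [folklore] -/
theorem dWeightNode_mem_Ioo {Δ tpd tpp c ε : ℝ} (hΔ : 0 < Δ) (hc : 0 ≤ c) (hg : c ≤ tpp) (hε : 0 < ε) (htpd : tpd ≠ 0) :
    dWeightNode Δ tpd tpp c ε ∈ Set.Ioo (0 : ℝ) 1 := by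
  rw [dWeightNode_eq hΔ.le hc hg hε htpd]
  have ht : 0 < tpd ^ 2 := lt_of_le_of_ne (sq_nonneg _) (Ne.symm (pow_ne_zero 2 htpd))
  have hgc : 0 ≤ (tpp - c) * ε ^ 2 := mul_nonneg (sub_nonneg.2 hg) (sq_nonneg _)
  have hD : 0 < 2 * tpd ^ 2 * (Δ + 2 * ε) + (tpp - c) * ε ^ 2 := by positivity
  constructor
  · positivity
  · rw [div_lt_one hD]
    nlinarith [mul_pos ht hε]

/-- The nodal state is more than half Cu-d iff `(t_pp − t_pp′)ε² < 2t_pd²Δ` (always at small doping of a charge-transfer insulator; the census rows have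
`dWeightNode ≈ 0.55–0.69`). [folklore] -/
theorem half_lt_dWeightNode_iff {Δ tpd tpp c ε : ℝ} (hΔ : 0 < Δ) (hc : 0 ≤ c) (hg : c ≤ tpp) (hε : 0 < ε) (htpd : tpd ≠ 0) :
    1 / 2 < dWeightNode Δ tpd tpp c ε ↔ (tpp - c) * ε ^ 2 < 2 * tpd ^ 2 * Δ := by
  rw [dWeightNode_eq hΔ.le hc hg hε htpd]
  have ht : 0 < tpd ^ 2 := lt_of_le_of_ne (sq_nonneg _) (Ne.symm (pow_ne_zero 2 htpd))
  have hgc : 0 ≤ (tpp - c) * ε ^ 2 := mul_nonneg (sub_nonneg.2 hg) (sq_nonneg _)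
  have hD : 0 < 2 * tpd ^ 2 * (Δ + 2 * ε) + (tpp - c) * ε ^ 2 := by positivity
  rw [lt_div_iff₀ hD]
  constructor
  · intro h; linarith
  · intro h; linarith

end Summit.Ventures.CertifiedManyBodySolver.Downfold.Emery
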